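import Summits.RiemannHypothesis.RiemannHypothesis.Theorems.HandoffDecomposition
import Summits.RiemannHypothesis.RiemannHypothesis.Theorems.HandoffCross
import Summits.RiemannHypothesis.RiemannHypothesis.Theorems.HandoffAnalytic
import HarnessLib

/-!
# HANDOFF — the SIGN of the new prime's entrance is decided in the EDGE LAYER, by parity (cell rh-explicit, TRACK «HANDOFF», seat theory-2 gen7, file XII-p)

HONEST FRAMING. Nothing here bears on the truth of RH; everything below is RH-free and elementary. The cell's DATA rule
«odd carries the wall, even carries the margin» (HANDOFF-STATEMENT §H.2; `HandoffWallSector`: at every semi-local wall ONE sector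
carries it — WHICH one is data) and idea-3's edge analysis (the bottom modes are single-signed and edge-loaded) get here the
following KERNEL MECHANISM. For a prime `q`, `L = log q`, and a test function `g` on `[−b, b]` with `L/2 < b < L` (the handoff
window and below `log q`), the contribution of `q` only sees the two EDGE LAYERS `[L − b, b]` and `[−b, b − L]`:
`contribution_q(g) = −(2 log q/√q)·Re ∫ g(u)·conj g(u − L) du` (`contribution_eq_integral`), the integrand living on `u ∈ [L − b, b]`.
* §1 SIGN FROM THE LAYER: if `Re(g(u)·conj g(u − L)) ≥ 0` pointwise then `contribution_q(g) ≤ 0`; if `≤ 0` pointwise then `≥ 0`.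
* §2 PARITY: for a REAL-valued test function that is `≥ 0` on the right edge layer `[L − b, b]`:
  **EVEN ⟹ `contribution_q(g) ≤ 0`** (the prime HARMS it: `g(u − L) = g(L − u) ≥ 0` on the layer), **ODD ⟹ `contribution_q(g) ≥ 0`**
  (the prime RESCUES it: `g(u − L) = −g(L − u) ≤ 0`). (`HandoffCapSharp` / gen6's Cramér pairs are the saturating instances `∓cap·‖g‖²`.)
* §3 ON THE HANDOFF WINDOW (consecutive primes `q < q'`, `tsupport g ⊆ [−b, b]`, `b ≤ (log q')/2`; `Re Q = contribution − deficit`):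
  for such an EVEN `g`, **`Re Q(g) ≤ Re Q_{S_q}(g)`** — deleting `q` can only RAISE its energy; for such an ODD `g`, **`Re Q_{S_q}(g) ≤ Re Q(g)`**.
  Consequences: (a) `re_weilSemilocalQuadratic_nonneg_of_even` — under the A1 input `0 ≤ ε_ev(b)` NO edge-positive even real function is a
  negative witness for the deleted form `Q_{S_q}` on `C(b)`: every even-sector negative witness of `S_q` inside `q`'s window (the A4 lineages'
  certified even wall vectors) must CHANGE SIGN inside the edge layer `[log q − b, b]` — unless `ε_ev(b) < 0`, i.e. unless RH fails
  (`not_riemannHypothesis_of_even_edgePositive_neg`: an edge-positive even negative witness of `S_q` at `b ≤ (log q')/2` refutes RH);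
  (b) `re_weilQuadratic_nonneg_of_odd` — NO-HARM holds RH-free for edge-positive ODD real functions: if the old form `Q_{S_q}` is `≥ 0` at such
  a `g`, so is Weil's form. So an even wall of `S_q` can only be carried by functions oscillating in the layer, while an odd wall can be carried
  by edge-positive functions — the kernel face of «odd carries the wall» (which sector actually carries it remains DATA).
References: A. Connes, C. Consani, Enseign. Math. 69 (2023) §2.2–§2.3 (`ConnesConsani2023`: the contribution of the new prime lives at lag
`log q`); E. Bombieri, Rend. Mat. Acc. Lincei (9) 11 (2000) §2 p. 186, §4 (`Bombieri2000Weil`: parity, windows). The statements are this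
track's bookkeeping.
-/

set_option linter.dupNamespace false  -- the mandated namespace repeats `RiemannHypothesis`

noncomputable section

open Complex Set MeasureTheory Literature.NumberTheory.LFunctions
open Summit.RiemannHypothesis.RiemannHypothesis.Theorems.Handoff
open Summit.RiemannHypothesis.RiemannHypothesis.Theorems.HandoffDecomposition (contribution_eq_two_mul)
open scoped ComplexConjugate

namespace Summit.RiemannHypothesis.RiemannHypothesis.Theorems.HandoffEntranceSignLayer

variable {g : ℝ → ℂ} {q q' : ℕ} {b : ℝ}

/-! ## §1 The layer integral and its sign -/

/-- The layer integrand `u ↦ g(u)·conj g(u − L)`. [folklore] -/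
theorem integrable_mul_conj_shift (hg : IsWeilTest g) (L : ℝ) :
    Integrable fun u : ℝ ↦ g u * conj (g (u - L)) := by
  refine Continuous.integrable_of_hasCompactSupport ?_ ?_
  · exact hg.1.continuous.mul (Complex.continuous_conj.comp (hg.1.continuous.comp (continuous_id.sub continuous_const)))
  · exact hg.2.mul_right

/-- **The contribution is a layer integral**: `contribution_q(g) = −(2 log q/√q)·Re ∫ g(u)·conj g(u − log q) du` (no hypothesis on `g`).
[cite: ConnesConsani2023, §2.2–§2.3] -/
theorem contribution_eq_integral (q : ℕ) (g : ℝ → ℂ) :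
    contribution q g = -(2 * Real.log q / Real.sqrt q * (∫ u : ℝ, g u * conj (g (u - Real.log q))).re) := by
  rw [contribution_eq_two_mul, weilConv_weilReflect_eq_integral]

/-- The weight `2 log q/√q ≥ 0`. [folklore] -/
theorem two_mul_log_div_sqrt_nonneg (q : ℕ) : 0 ≤ 2 * Real.log q / Real.sqrt q :=
  div_nonneg (mul_nonneg zero_le_two (Real.log_natCast_nonneg q)) (Real.sqrt_nonneg _)

/-- **Sign from the layer, I**: `Re(g(u)·conj g(u − log q)) ≥ 0` for all `u` ⟹ `contribution_q(g) ≤ 0`. [folklore] -/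
theorem contribution_nonpos_of_re_nonneg (hg : IsWeilTest g) (h : ∀ u : ℝ, 0 ≤ (g u * conj (g (u - Real.log q))).re) :
    contribution q g ≤ 0 := by
  rw [contribution_eq_integral, neg_nonpos]
  refine mul_nonneg (two_mul_log_div_sqrt_nonneg q) ?_
  have := integral_re (integrable_mul_conj_shift hg (Real.log q))
  rw [RCLike.re_eq_complex_re] at this
  rw [← this]
  exact integral_nonneg fun u ↦ by simpa only [Pi.zero_apply, RCLike.re_eq_complex_re] using h u

/-- **Sign from the layer, II**: `Re(g(u)·conj g(u − log q)) ≤ 0` for all `u` ⟹ `0 ≤ contribution_q(g)`. [folklore] -/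
theorem contribution_nonneg_of_re_nonpos (hg : IsWeilTest g) (h : ∀ u : ℝ, (g u * conj (g (u - Real.log q))).re ≤ 0) :
    0 ≤ contribution q g := by
  rw [contribution_eq_integral, neg_nonneg]
  refine mul_nonpos_of_nonneg_of_nonpos (two_mul_log_div_sqrt_nonneg q) ?_
  have := integral_re (integrable_mul_conj_shift hg (Real.log q))
  rw [RCLike.re_eq_complex_re] at this
  rw [← this]
  exact integral_nonpos fun u ↦ by simpa only [Pi.zero_apply, RCLike.re_eq_complex_re] using h u

/-! ## §2 Parity: a single-signed right edge layer decides the sign -/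

/-- For a real-valued `g`: `Re(g(u)·conj g(v)) = Re g(u) · Re g(v)`. [folklore] -/
theorem re_mul_conj_of_real (hreal : ∀ t, (g t).im = 0) (u v : ℝ) :
    (g u * conj (g v)).re = (g u).re * (g v).re := by
  rw [Complex.mul_re, Complex.conj_re, Complex.conj_im, hreal u, hreal v]; ring

/-- Where the layer integrand can be non-zero: if `tsupport g ⊆ [−b, b]` and `g u ≠ 0`, `g (u − L) ≠ 0`, then `u ∈ [L − b, b]` and
`L − u ∈ [L − b, b]`. [folklore] -/
theorem mem_layer_of_ne_zero (hsupp : tsupport g ⊆ Icc (-b) b) {L u : ℝ} (hu : g u ≠ 0) (huL : g (u - L) ≠ 0) :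
    u ∈ Icc (L - b) b ∧ L - u ∈ Icc (L - b) b := by
  have h1 : u ∈ Icc (-b) b := hsupp (by by_contra h; exact hu (image_eq_zero_of_notMem_tsupport h))
  have h2 : u - L ∈ Icc (-b) b := hsupp (by by_contra h; exact huL (image_eq_zero_of_notMem_tsupport h))
  exact ⟨⟨by linarith [h2.1], h1.2⟩, ⟨by linarith [h1.2], by linarith [h2.1]⟩⟩

/-- **EVEN, edge-positive ⟹ HARMED**: a real-valued even test function on `[−b, b]` with `Re g ≥ 0` on the right edge layer
`[log q − b, b]` has `contribution_q(g) ≤ 0`. [this track] -/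
theorem contribution_nonpos_of_even (hg : IsWeilTest g) (hsupp : tsupport g ⊆ Icc (-b) b) (hev : ∀ t, g (-t) = g t)
    (hreal : ∀ t, (g t).im = 0) (hpos : ∀ t ∈ Icc (Real.log q - b) b, 0 ≤ (g t).re) : contribution q g ≤ 0 := by
  refine contribution_nonpos_of_re_nonneg hg fun u ↦ ?_
  rw [re_mul_conj_of_real hreal]
  by_cases hu : g u = 0
  · simp [hu]
  by_cases huL : g (u - Real.log q) = 0
  · simp [huL]
  obtain ⟨h1, h2⟩ := mem_layer_of_ne_zero hsupp hu huL
  have e : g (u - Real.log q) = g (Real.log q - u) := by rw [← hev (u - Real.log q), neg_sub]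
  rw [e]
  exact mul_nonneg (hpos u h1) (hpos _ h2)

/-- **ODD, edge-positive ⟹ RESCUED**: a real-valued odd test function on `[−b, b]` with `Re g ≥ 0` on the right edge layer
`[log q − b, b]` has `0 ≤ contribution_q(g)`. [this track] -/
theorem contribution_nonneg_of_odd (hg : IsWeilTest g) (hsupp : tsupport g ⊆ Icc (-b) b) (hodd : ∀ t, g (-t) = -g t)
    (hreal : ∀ t, (g t).im = 0) (hpos : ∀ t ∈ Icc (Real.log q - b) b, 0 ≤ (g t).re) : 0 ≤ contribution q g := by
  refine contribution_nonneg_of_re_nonpos hg fun u ↦ ?_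
  rw [re_mul_conj_of_real hreal]
  by_cases hu : g u = 0
  · simp [hu]
  by_cases huL : g (u - Real.log q) = 0
  · simp [huL]
  obtain ⟨h1, h2⟩ := mem_layer_of_ne_zero hsupp hu huL
  have e : g (u - Real.log q) = -g (Real.log q - u) := by rw [← hodd (Real.log q - u), neg_sub]
  rw [e, Complex.neg_re]
  exact mul_nonpos_of_nonneg_of_nonpos (hpos u h1) (neg_nonpos.2 (hpos _ h2))

/-! ## §3 On the handoff window: deletion raises edge-positive even energies and lowers edge-positive odd ones -/

/-- **EVEN: deleting `q` can only RAISE the energy** — for consecutive primes `q < q'`, `b ≤ (log q')/2`, and a real even test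
function on `[−b, b]` non-negative on the right edge layer: `Re Q(g) ≤ Re Q_{S_q}(g)`. [this track] -/
theorem re_weilQuadratic_le_semilocal_of_even (h : ConsecutivePrimes q q') (hg : IsWeilTest g) (hb : b ≤ Real.log q' / 2)
    (hsupp : tsupport g ⊆ Icc (-b) b) (hev : ∀ t, g (-t) = g t) (hreal : ∀ t, (g t).im = 0)
    (hpos : ∀ t ∈ Icc (Real.log q - b) b, 0 ≤ (g t).re) :
    (weilQuadratic g).re ≤ (weilSemilocalQuadratic (Nat.primesBelow q) g).re := by
  have hsupp' : tsupport g ⊆ Icc (-(Real.log q' / 2)) (Real.log q' / 2) := hsupp.trans (Icc_subset_Icc (neg_le_neg hb) hb)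
  have hid := re_weilQuadratic_eq_contribution_sub_deficit h hg hsupp'
  have hc := contribution_nonpos_of_even (q := q) hg hsupp hev hreal hpos
  unfold deficit at hid
  linarith

/-- **ODD: deleting `q` can only LOWER the energy** — same setting, `g` odd: `Re Q_{S_q}(g) ≤ Re Q(g)`. [this track] -/
theorem re_semilocal_le_weilQuadratic_of_odd (h : ConsecutivePrimes q q') (hg : IsWeilTest g) (hb : b ≤ Real.log q' / 2)
    (hsupp : tsupport g ⊆ Icc (-b) b) (hodd : ∀ t, g (-t) = -g t) (hreal : ∀ t, (g t).im = 0)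
    (hpos : ∀ t ∈ Icc (Real.log q - b) b, 0 ≤ (g t).re) :
    (weilSemilocalQuadratic (Nat.primesBelow q) g).re ≤ (weilQuadratic g).re := by
  have hsupp' : tsupport g ⊆ Icc (-(Real.log q' / 2)) (Real.log q' / 2) := hsupp.trans (Icc_subset_Icc (neg_le_neg hb) hb)
  have hid := re_weilQuadratic_eq_contribution_sub_deficit h hg hsupp'
  have hc := contribution_nonneg_of_odd (q := q) hg hsupp hodd hreal hpos
  unfold deficit at hid
  linarith

/-- **(a) Under `0 ≤ ε_ev(b)` no edge-positive even real function is a negative witness for the deleted form**: `0 ≤ Re Q_{S_q}(g)`.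
So every even-sector negative witness of `S_q` on `C(b)`, `b ≤ (log q')/2`, changes sign inside the edge layer `[log q − b, b]` — unless
`ε_ev(b) < 0`. [this track] -/
theorem re_weilSemilocalQuadratic_nonneg_of_even (h : ConsecutivePrimes q q') (hg : IsWeilTest g) (hb : b ≤ Real.log q' / 2)
    (hsupp : tsupport g ⊆ Icc (-b) b) (hev : ∀ t, g (-t) = g t) (hreal : ∀ t, (g t).im = 0)
    (hpos : ∀ t ∈ Icc (Real.log q - b) b, 0 ≤ (g t).re) (hε : 0 ≤ weilEvenGroundEnergy b) :
    0 ≤ (weilSemilocalQuadratic (Nat.primesBelow q) g).re := by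
  have h1 := weilEvenGroundEnergy_mul_le_re hg hsupp hev
  have h2 : 0 ≤ weilEvenGroundEnergy b * ∫ t, ‖g t‖ ^ 2 := mul_nonneg hε (integral_nonneg fun t ↦ by positivity)
  exact (h2.trans h1).trans (re_weilQuadratic_le_semilocal_of_even h hg hb hsupp hev hreal hpos)

/-- … contrapositive, as a statement about witnesses: an even real test function on `[−b, b]`, `b ≤ (log q')/2`, with
`Re Q_{S_q}(g) < 0` and `Re g ≥ 0` on `[log q − b, b]` forces `ε_ev(b) < 0`. [this track] -/
theorem weilEvenGroundEnergy_neg_of_even_edgePositive_neg (h : ConsecutivePrimes q q') (hg : IsWeilTest g)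
    (hb : b ≤ Real.log q' / 2) (hsupp : tsupport g ⊆ Icc (-b) b) (hev : ∀ t, g (-t) = g t) (hreal : ∀ t, (g t).im = 0)
    (hpos : ∀ t ∈ Icc (Real.log q - b) b, 0 ≤ (g t).re) (hneg : (weilSemilocalQuadratic (Nat.primesBelow q) g).re < 0) :
    weilEvenGroundEnergy b < 0 := by
  by_contra hε
  exact (not_le.2 hneg) (re_weilSemilocalQuadratic_nonneg_of_even h hg hb hsupp hev hreal hpos (not_lt.1 hε))

/-- **… and is a negative witness of the FULL form**: an edge-positive even real negative witness of `S_q` on `C(b)`, `b ≤ (log q')/2`,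
violates Weil positivity on `C(b)` (`Re Q(g) ≤ Re Q_{S_q}(g) < 0`). [this track] -/
theorem not_weilPositivityOn_of_even_edgePositive_neg (h : ConsecutivePrimes q q') (hg : IsWeilTest g)
    (hb : b ≤ Real.log q' / 2) (hsupp : tsupport g ⊆ Icc (-b) b) (hev : ∀ t, g (-t) = g t) (hreal : ∀ t, (g t).im = 0)
    (hpos : ∀ t ∈ Icc (Real.log q - b) b, 0 ≤ (g t).re) (hneg : (weilSemilocalQuadratic (Nat.primesBelow q) g).re < 0) :
    ¬ WeilPositivityOn b := fun hW ↦ by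
  have h0 : 0 ≤ (weilQuadratic g).re := hW g hg hsupp
  linarith [re_weilQuadratic_le_semilocal_of_even h hg hb hsupp hev hreal hpos]

/-- **… hence refutes RH** (Weil's criterion, `rung_of_riemannHypothesis`): an edge-positive even real negative witness of `S_q` inside
`q`'s window `[(log q)/2, (log q')/2]` is incompatible with RH. So, as long as RH stands unrefuted this way, every certified even-sector
wall vector of the A4 lineages changes sign inside its edge layer `[log q − b, b]` — a falsifiable reading. [this track; cite:
Bombieri2000Weil, Thm 2 (p. 193) (Weil's criterion)] -/
theorem not_riemannHypothesis_of_even_edgePositive_neg (h : ConsecutivePrimes q q') (hg : IsWeilTest g)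
    (hqb : Real.log q / 2 ≤ b) (hb : b ≤ Real.log q' / 2) (hsupp : tsupport g ⊆ Icc (-b) b) (hev : ∀ t, g (-t) = g t)
    (hreal : ∀ t, (g t).im = 0) (hpos : ∀ t ∈ Icc (Real.log q - b) b, 0 ≤ (g t).re)
    (hneg : (weilSemilocalQuadratic (Nat.primesBelow q) g).re < 0) : ¬ Summit.RiemannHypothesis := by
  intro hRH
  have hq1 : (1 : ℝ) < q := by exact_mod_cast h.1.one_lt
  have hb0 : 0 < b := lt_of_lt_of_le (by have := Real.log_pos hq1; positivity) hqb
  have hW : WeilPositivityOn b := MotivicDoor.Rungs.rung_of_riemannHypothesis (Summit.RiemannHypothesis_iff.1 hRH) hb0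
  have h0 : 0 ≤ (weilQuadratic g).re := hW g hg hsupp
  linarith [re_weilQuadratic_le_semilocal_of_even h hg hb hsupp hev hreal hpos]

/-- **(b) NO-HARM is RH-free for edge-positive odd real functions**: if the old form `Q_{S_q}` is non-negative at such a `g`
(`b ≤ (log q')/2`), so is Weil's form. [this track] -/
theorem re_weilQuadratic_nonneg_of_odd (h : ConsecutivePrimes q q') (hg : IsWeilTest g) (hb : b ≤ Real.log q' / 2)
    (hsupp : tsupport g ⊆ Icc (-b) b) (hodd : ∀ t, g (-t) = -g t) (hreal : ∀ t, (g t).im = 0)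
    (hpos : ∀ t ∈ Icc (Real.log q - b) b, 0 ≤ (g t).re) (hold : 0 ≤ (weilSemilocalQuadratic (Nat.primesBelow q) g).re) :
    0 ≤ (weilQuadratic g).re :=
  hold.trans (re_semilocal_le_weilQuadratic_of_odd h hg hb hsupp hodd hreal hpos)

/-- **(b′) The odd wall candidates**: if Weil's form is `< 0` at NO odd function of the window (`0 ≤ ε_od(b)`) but the deleted form is
negative at an edge-positive odd real `g`, then `0 ≤ Re Q(g)` and `Re Q_{S_q}(g) < 0` are compatible — the prime `q` RESCUES `g` by at most
`cap(q)‖g‖₂²`; quantitatively `Re Q_{S_q}(g) ≥ ε_od(b)‖g‖₂² − contribution_q(g)`. [this track] -/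
theorem re_semilocal_ge_of_odd (h : ConsecutivePrimes q q') (hg : IsWeilTest g) (hb : b ≤ Real.log q' / 2)
    (hsupp : tsupport g ⊆ Icc (-b) b) (hodd : ∀ t, g (-t) = -g t) :
    weilOddGroundEnergy b * (∫ t, ‖g t‖ ^ 2) - contribution q g ≤ (weilSemilocalQuadratic (Nat.primesBelow q) g).re := by
  have hsupp' : tsupport g ⊆ Icc (-(Real.log q' / 2)) (Real.log q' / 2) := hsupp.trans (Icc_subset_Icc (neg_le_neg hb) hb)
  have hid := re_weilQuadratic_eq_contribution_sub_deficit h hg hsupp'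
  have h1 := weilOddGroundEnergy_mul_le_re hg hsupp hodd
  unfold deficit at hid
  linarith

end Summit.RiemannHypothesis.RiemannHypothesis.Theorems.HandoffEntranceSignLayer

end
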